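import Summits.ValiantsHypothesis.ValiantsHypothesis.Theorems.KPlusLogSqLawTropicalBCosetSkeleton

/-!
# Route «KPlusLogSqLaw», crux `TropicalB` (stmt-ValiantsHypothesis-19771) — THE BLOCK-IMAGE LAW for ARBITRARY chains:
# `n + 1 ≤ Σ_{visited block-image vectors 𝐑} (1 + Σ_j (|W_j(𝐑)| − 1)) ≤ V_blk · (1 + Σ_j (multichoose K |B_j| − 1))`

HONEST FRAMING.  Helper toward the registered stubs `stub_tropThin` / `stub_tropFat` of `Cruxes/TropicalB/Lines/birth.lean`
(crux `Summit.ValiantsHypothesis.ValiantsHypothesis.Theses.KPlusLogSqLaw.TropicalB`, item stmt-ValiantsHypothesis-19771, route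
KPlusLogSqLaw; cell `pub-symmetroid`, seat val-sym-trop-p4 g10, 2026-08-27; `--supports … --as helper`).  A STRUCTURE LAW about
chains of unique optima of an ARBITRARY dominance design (no support class, no exponent regime, no sign condition); a bound-less
reduction («calibration» class): it bounds the chain by the number `V_blk` of block-image vectors the chain visits and does NOT bound
`V_blk`.  Nothing here bears on `TropicalB` in its window, on `WeakLifting`, DoorA26 / DoorA34, `MatrixDescartes`
(stmt-ValiantsHypothesis-18050) or VP ≠ VNP.

SETTING.  Columns are partitioned into blocks by an arbitrary map `blk : Fin m → Fin s` (`B_j = blk⁻¹ j`).  The BLOCK-IMAGE VECTOR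
of a term `(σ, λ)` is `j ↦ σ(B_j)` (a vector of row sets); `V_blk` is the number of distinct block-image vectors along the chain; for a
fixed vector `𝐑`, `W_j(𝐑)` is the set of block-`j` exponent masses `Σ_{b ∈ B_j} d(λ b)` occurring among the chain terms whose
block-image vector is `𝐑`.

THE LAW.  For every design `(d, v, ε)` of any format and every chain `q₀, …, qₙ` of terms dominant at strictly increasing integer
slopes with consecutive terms distinct:

* `blockImage_law`       — `n + 1 ≤ Σ_{𝐑 visited} (1 + Σ_j (|W_j(𝐑)| − 1))`;
* `blockImage_law_count` — `n + 1 ≤ V_blk · (1 + Σ_j (multichoose K |B_j| − 1))` (since `|W_j(𝐑)| ≤ multichoose K |B_j|`);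
* `blockImage_law_count_signed` — the same under the crux's hypotheses (sign-alternating chain).

ONE LAW, THREE TREE THEOREMS AS ITS ENDS.  `s = 1` (one block): `V_blk = 1` and the law is slope counting
`n + 1 ≤ multichoose K m` (`TropicalCensus.tropRootLawAt_slopeCount`); singleton blocks (`blk = id`): the block-image vector IS the
permutation, `V_blk = #{σ_k}` and the law is the permutation budget `n + 1 ≤ #{σ_k}·(m(K−1)+1)` (`…TropicalPermutationChanges
.succ_le_card_perms_mul`, `…TropicalBSwitchBudget`); chains with permutations `g ∘ τ`, `g ∈ G`, `τ` block-local (`…TropicalBCosetSkeleton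
.cosetSkeleton_law`, val-sym-trop-p4 g9): the block-image vector is determined by `g`, so `V_blk ≤ |G|`.  In between it is the
`s`-block form of the split / visited-image accounting of val-sym-trop-p1 (`designRowD_split`, `…TropicalBVisitedImages`, two blocks,
recursive) with COUNTING in the blocks — the item «s-block split» of the g9 closing list (HOME/HANDOFF.md, val-sym-trop-p4 g9 NEXT (0)).
PROOF.  Two chain terms with the same block-image vector have a BLOCK-LOCAL quotient (`blockLocal_of_imageVec_eq`), so g9's block
exchange `CosetSkeleton.blockSlope_le` applies inside every image class: block-slope vectors increase coordinatewise, strictly in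
total (`TropicalCensus.slope_lt_of_dominant`); the rank potential `CosetSkeleton.card_chain_le` bounds the class by
`1 + Σ_j (|W_j| − 1)`; summing over the visited vectors (`Finset.card_eq_sum_card_fiberwise`) gives the law.  READING (located, not
claimed): a counterexample to the `K + log² m` law visits, for EVERY block map, super-quasi-polynomially many block-image vectors
relative to `1 + Σ_j (multichoose K |B_j| − 1)` — e.g. for blocks of size `K` at least `(n+1)·K / (m·4^K)` of them.
[this cell; the exchange inequality is folklore]
-/

set_option linter.dupNamespace false
set_option autoImplicit false

namespace Summit.ValiantsHypothesis.ValiantsHypothesis.Theorems.KPlusLogSqLaw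

namespace BlockImage

open Summit.ValiantsHypothesis.ValiantsHypothesis.Theorems.MatrixDescartes.Negative
open Summit.ValiantsHypothesis.ValiantsHypothesis.Theorems.LacunarySymmetroidMatrixDescartes
open Summit.ValiantsHypothesis.ValiantsHypothesis.Theorems.LacunarySymmetroidMatrixDescartes.TropicalCensus
open Finset

variable {m K s : ℕ}

/-- **same block images ⇒ block-local quotient.**  If two permutations map every column block onto the same row set, then
`σ'⁻¹ ∘ σ` preserves the blocks. [folklore] -/
theorem blockLocal_of_imageVec_eq (blk : Fin m → Fin s) {σ σ' : Equiv.Perm (Fin m)}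
    (h : (fun j : Fin s => (univ.filter fun b => blk b = j).image σ) =
      fun j : Fin s => (univ.filter fun b => blk b = j).image σ') (b : Fin m) :
    blk (σ'.symm (σ b)) = blk b := by
  classical
  have hmem : σ b ∈ (univ.filter fun b' => blk b' = blk b).image σ :=
    mem_image.mpr ⟨b, mem_filter.mpr ⟨mem_univ _, rfl⟩, rfl⟩
  have h' : (univ.filter fun b' => blk b' = blk b).image σ = (univ.filter fun b' => blk b' = blk b).image σ' :=
    congrFun h (blk b)
  rw [h'] at hmem
  obtain ⟨b', hb', hb'eq⟩ := mem_image.mp hmem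
  rw [← hb'eq, Equiv.symm_apply_apply]
  exact (mem_filter.mp hb').2

/-- **THE BLOCK-IMAGE LAW (fine form).**  Any dominance design; a chain `q₀, …, qₙ` of terms dominant at strictly increasing
integer slopes with consecutive terms distinct; any column-block map `blk`.  Then
`n + 1 ≤ Σ_{𝐑 visited} (1 + Σ_j (|W_j(𝐑)| − 1))`, where `𝐑` runs over the block-image vectors `j ↦ σ_k(B_j)` visited by the chain and
`W_j(𝐑)` is the set of block-`j` exponent masses of the chain terms with block-image vector `𝐑`. [this cell] -/
theorem blockImage_law (blk : Fin m → Fin s) (d : Fin K → ℕ) (v ε : Fin m → Fin m → Fin K → ℤ)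
    {n : ℕ} (θ : Fin (n + 1) → ℤ) (q : Fin (n + 1) → Equiv.Perm (Fin m) × (Fin m → Fin K))
    (hθ : StrictMono θ) (hdom : ∀ k, IsDominant d v ε (θ k) (q k))
    (hne : ∀ k : Fin n, q k.castSucc ≠ q k.succ) :
    n + 1 ≤ ∑ R ∈ univ.image (fun k => fun j : Fin s => (univ.filter fun b => blk b = j).image (q k).1),
      (1 + ∑ j : Fin s,
        (((univ.filter fun k => (fun j : Fin s => (univ.filter fun b => blk b = j).image (q k).1) = R).image
          fun k => ∑ b ∈ univ.filter (fun b => blk b = j), (d ((q k).2 b) : ℤ)).card - 1)) := by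
  classical
  -- the block-image vector of each chain term
  set img : Fin (n + 1) → (Fin s → Finset (Fin m)) :=
    fun k => fun j : Fin s => (univ.filter fun b => blk b = j).image (q k).1 with himg
  -- block slopes and their sum
  set w : Fin (n + 1) → Fin s → ℤ := fun k j => ∑ b ∈ univ.filter (fun b => blk b = j), (d ((q k).2 b) : ℤ) with hw
  have hsumw : ∀ k, ∑ j, w k j = TropicalCensus.slope d (q k) := by
    intro k
    simp only [hw]
    exact Finset.sum_fiberwise univ blk fun b => (d ((q k).2 b) : ℤ)
  have hsm : StrictMono fun k => TropicalCensus.slope d (q k) := by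
    rw [Fin.strictMono_iff_lt_succ]
    intro k
    exact slope_lt_of_dominant d v ε (hθ Fin.castSucc_lt_succ) (hne k) (hdom _) (hdom _)
  -- same image vector ⇒ block-local quotient ⇒ block slopes increase coordinatewise
  have hle : ∀ k k', k < k' → img k = img k' → ∀ j, w k j ≤ w k' j := by
    intro k k' hkk' hii j
    have hloc : ∀ b, blk ((q k').1.symm ((q k).1 b)) = blk b :=
      fun b => blockLocal_of_imageVec_eq blk (by simpa only [himg] using hii) b
    exact CosetSkeleton.blockSlope_le d v ε blk (hθ hkk') (q k) (q k') (hdom k) (hdom k') hloc j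
  -- count each image class with the rank potential
  have hclass : ∀ R, (univ.filter fun k => img k = R).card ≤
      1 + ∑ j : Fin s, (((univ.filter fun k => img k = R).image fun k => w k j).card - 1) := by
    intro R
    set T := univ.filter fun k => img k = R with hT
    exact CosetSkeleton.card_chain_le T w (by
      intro i hi i' hi' hii'
      rw [hT, Finset.mem_filter] at hi hi'
      have hii : img i = img i' := by rw [hi.2, hi'.2]
      rcases lt_or_gt_of_ne hii' with h | h
      · left
        refine ⟨hle i i' h hii, ?_⟩
        rw [hsumw, hsumw]; exact hsm h
      · right
        refine ⟨hle i' i h hii.symm, ?_⟩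
        rw [hsumw, hsumw]; exact hsm h)
  -- sum over the visited image vectors
  have hpart := Finset.card_eq_sum_card_fiberwise (s := (univ : Finset (Fin (n + 1)))) (t := univ.image img) (f := img)
    (fun k hk => mem_image_of_mem img hk)
  rw [card_univ, Fintype.card_fin] at hpart
  show n + 1 ≤ ∑ R ∈ univ.image img, (1 + ∑ j : Fin s, (((univ.filter fun k => img k = R).image fun k => w k j).card - 1))
  calc n + 1 = ∑ R ∈ univ.image img, (univ.filter fun k => img k = R).card := hpart
    _ ≤ _ := Finset.sum_le_sum fun R _ => hclass R

/-- **THE BLOCK-IMAGE LAW (counting form).**  With `V_blk` the number of distinct block-image vectors visited by the chain,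
`n + 1 ≤ V_blk · (1 + Σ_j (multichoose K |B_j| − 1))`.  Ends: one block ⇒ slope counting; singleton blocks ⇒ the permutation budget
`#{σ_k}·(m(K−1)+1)`; `g ∘ (block-local)` chains ⇒ the coset-skeleton law (`V_blk ≤ |G|`). [this cell] -/
theorem blockImage_law_count (blk : Fin m → Fin s) (d : Fin K → ℕ) (v ε : Fin m → Fin m → Fin K → ℤ)
    {n : ℕ} (θ : Fin (n + 1) → ℤ) (q : Fin (n + 1) → Equiv.Perm (Fin m) × (Fin m → Fin K))
    (hθ : StrictMono θ) (hdom : ∀ k, IsDominant d v ε (θ k) (q k))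
    (hne : ∀ k : Fin n, q k.castSucc ≠ q k.succ) :
    n + 1 ≤ (univ.image fun k => fun j : Fin s => (univ.filter fun b => blk b = j).image (q k).1).card *
      (1 + ∑ j : Fin s, (Nat.multichoose K (univ.filter fun b => blk b = j).card - 1)) := by
  classical
  refine (blockImage_law blk d v ε θ q hθ hdom hne).trans ?_
  set img : Fin (n + 1) → (Fin s → Finset (Fin m)) :=
    fun k => fun j : Fin s => (univ.filter fun b => blk b = j).image (q k).1 with himg
  have hclass : ∀ R ∈ univ.image img,
      (1 + ∑ j : Fin s, (((univ.filter fun k => img k = R).image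
          fun k => ∑ b ∈ univ.filter (fun b => blk b = j), (d ((q k).2 b) : ℤ)).card - 1)) ≤
        1 + ∑ j : Fin s, (Nat.multichoose K (univ.filter fun b => blk b = j).card - 1) := by
    intro R _
    have h2 : ∀ j : Fin s, ((univ.filter fun k => img k = R).image
        fun k => ∑ b ∈ univ.filter (fun b => blk b = j), (d ((q k).2 b) : ℤ)).card - 1 ≤
        Nat.multichoose K (univ.filter fun b => blk b = j).card - 1 := fun j =>
      Nat.sub_le_sub_right (CosetSkeleton.card_blockSlopes_le d (univ.filter fun b => blk b = j) _ q) 1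
    have := Finset.sum_le_sum fun j (_ : j ∈ (univ : Finset (Fin s))) => h2 j
    omega
  calc ∑ R ∈ univ.image img, (1 + ∑ j : Fin s, (((univ.filter fun k => img k = R).image
          fun k => ∑ b ∈ univ.filter (fun b => blk b = j), (d ((q k).2 b) : ℤ)).card - 1))
      ≤ ∑ R ∈ univ.image img, (1 + ∑ j : Fin s, (Nat.multichoose K (univ.filter fun b => blk b = j).card - 1)) :=
        Finset.sum_le_sum hclass
    _ = (univ.image img).card * (1 + ∑ j : Fin s, (Nat.multichoose K (univ.filter fun b => blk b = j).card - 1)) := by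
        rw [Finset.sum_const, smul_eq_mul]

/-- the counting form for SIGN-ALTERNATING chains (the crux's hypotheses). [this cell] -/
theorem blockImage_law_count_signed (blk : Fin m → Fin s) (d : Fin K → ℕ) (v ε : Fin m → Fin m → Fin K → ℤ)
    {n : ℕ} (θ : Fin (n + 1) → ℤ) (q : Fin (n + 1) → Equiv.Perm (Fin m) × (Fin m → Fin K))
    (hθ : StrictMono θ) (hdom : ∀ k, IsDominant d v ε (θ k) (q k))
    (halt : ∀ k : Fin n, termSign ε (q k.castSucc) * termSign ε (q k.succ) < 0) :
    n + 1 ≤ (univ.image fun k => fun j : Fin s => (univ.filter fun b => blk b = j).image (q k).1).card *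
      (1 + ∑ j : Fin s, (Nat.multichoose K (univ.filter fun b => blk b = j).card - 1)) := by
  refine blockImage_law_count blk d v ε θ q hθ hdom (fun k h => ?_)
  have := halt k
  rw [h] at this
  exact absurd this (not_lt.mpr (mul_self_nonneg _))

/-! ## The two ends of the law, for the record -/

/-- **one block** (`s = 1`): every chain visits exactly one block-image vector (all rows), and the law is slope counting
`n + 1 ≤ multichoose K m`. [this cell; the bound itself is the tree's `tropRootLawAt_slopeCount`] -/
theorem blockImage_law_one_block (d : Fin K → ℕ) (v ε : Fin m → Fin m → Fin K → ℤ)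
    {n : ℕ} (θ : Fin (n + 1) → ℤ) (q : Fin (n + 1) → Equiv.Perm (Fin m) × (Fin m → Fin K))
    (hθ : StrictMono θ) (hdom : ∀ k, IsDominant d v ε (θ k) (q k))
    (hne : ∀ k : Fin n, q k.castSucc ≠ q k.succ) :
    n + 1 ≤ Nat.multichoose K m := by
  classical
  have h := blockImage_law_count (fun _ : Fin m => (0 : Fin 1)) d v ε θ q hθ hdom hne
  -- one visited vector: every permutation maps the single block onto all rows
  have hfull : ∀ (j : Fin 1) (σ : Equiv.Perm (Fin m)),
      (univ.filter fun b : Fin m => (0 : Fin 1) = j).image σ = univ := by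
    intro j σ
    rw [Finset.filter_true_of_mem fun b _ => Subsingleton.elim _ _]
    exact Finset.image_univ_equiv σ
  have hV : (univ.image fun k => fun j : Fin 1 => (univ.filter fun b : Fin m => (0 : Fin 1) = j).image (q k).1).card ≤ 1 := by
    refine Finset.card_le_one.mpr fun x hx y hy => ?_
    obtain ⟨k, -, rfl⟩ := mem_image.mp hx
    obtain ⟨k', -, rfl⟩ := mem_image.mp hy
    funext j
    rw [hfull, hfull]
  -- the single block has `m` columns
  have hX : 1 + ∑ j : Fin 1, (Nat.multichoose K (univ.filter fun b : Fin m => (0 : Fin 1) = j).card - 1) =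
      1 + (Nat.multichoose K m - 1) := by
    rw [Fin.sum_univ_one, Finset.filter_true_of_mem fun b _ => rfl, card_univ, Fintype.card_fin]
  -- `multichoose K m ≥ 1`: the chain has a term, whose class multiset exists
  have hpos : 1 ≤ Nat.multichoose K m := by
    have := CosetSkeleton.card_blockSlopes_le d (univ : Finset (Fin m)) (univ : Finset (Fin (n + 1))) q
    rw [card_univ, Fintype.card_fin] at this
    have hne' : (univ.image fun i : Fin (n + 1) => ∑ b ∈ (univ : Finset (Fin m)), (d ((q i).2 b) : ℤ)).Nonempty :=
      ⟨_, mem_image_of_mem _ (mem_univ 0)⟩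
    exact (Finset.card_pos.mpr hne').trans_le this
  rw [hX] at h
  calc n + 1 ≤ _ := h
    _ ≤ 1 * (1 + (Nat.multichoose K m - 1)) := Nat.mul_le_mul_right _ hV
    _ = Nat.multichoose K m := by omega

/-- **singleton blocks** (`blk = id`): the block-image vector determines the permutation, so `V_blk` is the number of distinct
permutations of the chain and the law reads `n + 1 ≤ #{σ_k} · (1 + m(K−1))` — the permutation budget of
`…TropicalPermutationChanges.succ_le_card_perms_mul` recovered as the other end of the same law. [this cell] -/
theorem blockImage_law_singletons (d : Fin K → ℕ) (v ε : Fin m → Fin m → Fin K → ℤ)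
    {n : ℕ} (θ : Fin (n + 1) → ℤ) (q : Fin (n + 1) → Equiv.Perm (Fin m) × (Fin m → Fin K))
    (hθ : StrictMono θ) (hdom : ∀ k, IsDominant d v ε (θ k) (q k))
    (hne : ∀ k : Fin n, q k.castSucc ≠ q k.succ) :
    n + 1 ≤ (univ.image fun k => (q k).1).card * (1 + m * (K - 1)) := by
  classical
  have h := blockImage_law_count (fun b : Fin m => b) d v ε θ q hθ hdom hne
  -- the image vector of singleton blocks determines the permutation
  have hV : (univ.image fun k => fun j : Fin m => (univ.filter fun b : Fin m => b = j).image (q k).1).card ≤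
      (univ.image fun k => (q k).1).card := by
    have hfac : (univ.image fun k => fun j : Fin m => (univ.filter fun b : Fin m => b = j).image (q k).1) =
        (univ.image fun k => (q k).1).image
          fun σ : Equiv.Perm (Fin m) => fun j : Fin m => (univ.filter fun b : Fin m => b = j).image σ := by
      rw [Finset.image_image]; rfl
    rw [hfac]
    exact Finset.card_image_le
  -- each singleton block contributes `multichoose K 1 − 1 = K − 1`
  have hB : ∀ j : Fin m, (univ.filter fun b : Fin m => b = j).card = 1 := by
    intro j
    rw [Finset.filter_eq' univ j, if_pos (mem_univ j), card_singleton]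
  have hsum : ∑ j : Fin m, (Nat.multichoose K (univ.filter fun b : Fin m => b = j).card - 1) = m * (K - 1) := by
    simp_rw [hB, Nat.multichoose_one_right]
    rw [Finset.sum_const, card_univ, Fintype.card_fin, smul_eq_mul]
  rw [hsum] at h
  exact h.trans (Nat.mul_le_mul_right _ hV)

end BlockImage

end Summit.ValiantsHypothesis.ValiantsHypothesis.Theorems.KPlusLogSqLaw
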